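import Literature.Claims.NS.Lin2013
import Literature.Analysis.FluidPDE.ClassicalSolutionTorusProofs
import Literature.Analysis.FluidPDE.TorusClassicalLerayHopfProofs
import Literature.Analysis.FluidPDE.PeriodicBoxTorus
import Literature.Analysis.FluidPDE.CoordDerivatives
import Literature.Analysis.FluidPDE.TaoClassGlobal
import Literature.Analysis.FunctionSpaces.FlatTorusProofs
import Literature.Analysis.FunctionSpaces.TorusClassicalNSGluing
import Literature.Analysis.FluidPDE.TorusNSEnstrophyContinuation
import Literature.Analysis.FluidPDE.TorusBKMGradientLogBound
import Literature.Analysis.FluidPDE.TorusStrainVorticityIsometry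
import Literature.Analysis.FluidPDE.PeriodicGalileanNonuniqueness
import HarnessLib

/-!
# Solo salvage for claim C21 `Lin2013` (cell `ns-claims`, D-0090): the energy bound (Step 3) is
# TRUE — kernel discharge through the flat-torus bridge

Claim skeleton: `Literature/Claims/NS/Lin2013.lean` (typist `ns-claims-typist-3`/`-10`; Qun Lin,
arXiv:1308.2297 v14, «On the Regularity for 3D Navier–Stokes Equation», periodic problem).
Adjudicated #28: first failing step `Literature.Claims.NS.Lin2013.Step_5` (§2 one-step bound,
print p.11), class unfilled gap. This file (seat `ns-claims-salvage-p3`) kernel-discharges the TRUE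
classical step that precedes the locator:

* `lin2013_step3_holds : Step_3` — the energy bound (2)/(6), l.738–750: for every classical ℤ³-periodic
  solution of the unforced system on `ℝ³ × [0,T)` and every `t < T`,
  `∫_Ω |u(t)|² + ∫₀ᵗ ∫_Ω |∇u|² ≤ (1 + 1/(2ν)) ∫_Ω |u(0)|²`, `Ω = (0,1)³`. Source of the mathematics:
  Leray 1934 (energy equality for regular solutions); torus form Doering–Foias 2002 (2.4) /
  Robinson–Rodrigo–Sadowski 2016 Thm 6.5 — in the tree as
  `Torus.IsClassicalNSSolutionOn.energy_eq`.

The work is the BRIDGE from the claim's vocabulary (classical solutions on `ℝ³` with lattice-periodic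
slices, integrals over the open cell `(0,1)³`, operator norm of `fderiv`) to the tree's torus
vocabulary (`Torus.IsClassicalNSSolutionOn`, integrals over `𝕋³`, Frobenius sum of partial
derivatives):

* `exists_torus_of_isPeriodicClassicalOn` — a periodic classical solution on `ℝ³ × S` descends to
  a torus classical solution whose lifts are the given slices on `S` (`Torus.lift_descend_holds`,
  `IsClassicalNSSolutionOn.congr_slices`, `IsClassicalNSSolutionOn.to_torus_holds`);
* `cellSq_lift` — `∫_{(0,1)³} |lift V|² = ∫_{𝕋³} |V|²` (`PeriodicCylinder.openCube_ae_eq_unitCube`,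
  `Torus.integral_eq_integral_lift_holds`);
* `cellGradSq_lift_le` — `∫_{(0,1)³} ‖D(lift V)‖_op² ≤ ‖∇V‖₂²` (operator norm ≤ Frobenius norm,
  `sq_opNorm_le_sum_sq_norm_apply_stdVec`; the claim's `cellGradSq` is the WEAKER functional).

* `lin2013_step2_holds : Step_2` (rev 2) — §2 opening l.213–214 with §6: a classical ℤ³-periodic
  solution on `ℝ³ × [0,T)` whose enstrophy `∫_Ω|curl u(t)|²` is bounded on `[0,T)` continues to a
  classical periodic solution on a longer interval. Mathematics = the `H¹` continuation criterion
  (Robinson–Rodrigo–Sadowski 2016 Lemma 6.11, in the tree as the «enstrophy door»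
  `Torus.classicalNS_continuation_of_gradNormSq_le`, mean-zero slices on `𝕋³`); the work here is
  again the bridge: descent, removal of the (conserved) mean velocity by a Galilean boost
  (`IsClassicalNSSolutionOn.galileanBoost_const_Ico`, Majda–Bertozzi 2002 §1.2), the identity
  `∫_{(0,1)³}|curl (lift V)|² = ‖∇V‖₂²` for divergence-free `V` (`cellSq_curl_lift`, via
  `Torus.norm_curl_lift_sq` and `integral_torusVorticitySqAt_eq_two_mul_torusEnstrophy`), the lift
  back (`IsClassicalNSSolutionOn.of_torus_holds`) and the inverse boost.

Solo lane (`Theorems/SoloSalvage<Slug>.lean`, no item).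

WHAT THIS IS NOT: not a claim about NS regularity or blow-up; not a claim about any author beyond the
typed locator.
-/

noncomputable section

-- The summit-side namespace repeats the summit name by design (D-0017 layout); tree precedent
-- `SoloSalvageLam2019.lean`.
set_option linter.dupNamespace false

open MeasureTheory Set Filter
open scoped InnerProductSpace ContDiff

namespace Summit.NavierStokesRegularity.NavierStokesRegularity.Theorems.Lin2013Salvage

open Literature.Analysis.FluidPDE Literature.Analysis.FunctionSpaces Literature.Claims.NS.Lin2013

/-! ### The bridge: periodic classical solutions on `ℝ³` descend to the torus -/

/-- **Descent.** A classical solution of the unforced system on `ℝ³ × S` with lattice-periodic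
velocity and pressure slices (`IsPeriodicClassicalOn`) is, on `S`, the lift of a classical
solution on the flat torus `𝕋³ × S` (Lemarié-Rieusset 2016 §1.3 (1.10)–(1.13); tree
`IsClassicalNSSolutionOn.to_torus_holds` after replacing the slices off `S` by periodic ones). -/
theorem exists_torus_of_isPeriodicClassicalOn {S : Set ℝ} {ν : ℝ} {u : ℝ → (EuclideanSpace ℝ (Fin 3)) → (EuclideanSpace ℝ (Fin 3))}
    {p : ℝ → (EuclideanSpace ℝ (Fin 3)) → ℝ} (h : IsPeriodicClassicalOn S ν u p) :
    ∃ (U : ℝ → UnitAddTorus (Fin 3) → (EuclideanSpace ℝ (Fin 3))) (P : ℝ → UnitAddTorus (Fin 3) → ℝ),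
      Torus.IsClassicalNSSolutionOn S ν 0 U P ∧
        (∀ t ∈ S, u t = Torus.lift (U t)) ∧ ∀ t ∈ S, p t = Torus.lift (P t) := by
  classical
  obtain ⟨hNS, hper⟩ := h
  let U : ℝ → UnitAddTorus (Fin 3) → (EuclideanSpace ℝ (Fin 3)) := fun t =>
    if ht : t ∈ S then Torus.descend (u t) (fun j x => (hper t ht).1 j x) else 0
  let P : ℝ → UnitAddTorus (Fin 3) → ℝ := fun t =>
    if ht : t ∈ S then Torus.descend (p t) (fun j x => (hper t ht).2 j x) else 0
  have hU : ∀ t ∈ S, (fun s => Torus.lift (U s)) t = u t := fun t ht => by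
    simp only [U, dif_pos ht]
    exact Torus.lift_descend_holds _ _
  have hP : ∀ t ∈ S, (fun s => Torus.lift (P s)) t = p t := fun t ht => by
    simp only [P, dif_pos ht]
    exact Torus.lift_descend_holds _ _
  refine ⟨U, P, ?_, fun t ht => (hU t ht).symm, fun t ht => (hP t ht).symm⟩
  have h' : IsClassicalNSSolutionOn S ν
      (fun t => Torus.lift ((0 : ℝ → UnitAddTorus (Fin 3) → (EuclideanSpace ℝ (Fin 3))) t))
      (fun t => Torus.lift (U t)) (fun t => Torus.lift (P t)) := by
    have h1 := hNS.congr_slices hU hP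
    have h0 : (fun t => Torus.lift ((0 : ℝ → UnitAddTorus (Fin 3) → (EuclideanSpace ℝ (Fin 3))) t)) =
        (0 : ℝ → (EuclideanSpace ℝ (Fin 3)) → (EuclideanSpace ℝ (Fin 3))) := by
      funext t x
      simp [Torus.lift_apply]
    rw [h0]
    exact h1
  exact IsClassicalNSSolutionOn.to_torus_holds h'

/-! ### Cell integrals versus torus integrals -/

/-- The claim's open cell `(0,1)³` is the tree's `PeriodicCylinder.openCube`. -/
theorem cell_eq_openCube : (cell : Set (EuclideanSpace ℝ (Fin 3))) = PeriodicCylinder.openCube := rfl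

/-- `∫_{(0,1)³} |lift V|² = ∫_{𝕋³} |V|²`: the open cell and the half-open fundamental domain
`[0,1)³` differ by a null set, and `proj` is measure preserving from `[0,1)³` onto `𝕋³`
(Grafakos §3.1.1). -/
theorem cellSq_lift (V : UnitAddTorus (Fin 3) → (EuclideanSpace ℝ (Fin 3))) : cellSq (Torus.lift V) = ∫ y, ‖V y‖ ^ 2 := by
  unfold cellSq
  rw [cell_eq_openCube, setIntegral_congr_set PeriodicCylinder.openCube_ae_eq_unitCube,
    Torus.integral_eq_integral_lift_holds (fun y => ‖V y‖ ^ 2)]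
  simp only [Torus.lift_apply]

/-- The lift of a continuous function on `𝕋³` is integrable on the fundamental domain `[0,1)³`. -/
theorem integrableOn_lift_unitCube {G : UnitAddTorus (Fin 3) → ℝ} (hG : Continuous G) :
    IntegrableOn (Torus.lift G) (Torus.unitCube (Fin 3)) volume := by
  have hmp := Torus.measurePreserving_proj_unitCube_holds (d := Fin 3)
  have hGi : Integrable G volume := hG.integrable_unitAddTorus
  exact (hmp.integrable_comp hGi.aestronglyMeasurable).2 hGi

/-- `∫_{(0,1)³} ‖D(lift V)‖_op² ≤ ‖∇V‖₂² = ∫_{𝕋³} ∑ᵢ ‖∂ᵢV‖²` for smooth `V`: pointwise the operator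
norm of the derivative is at most its Frobenius norm, and `lift (∂ᵢ V) = D(lift V) eᵢ`. -/
theorem cellGradSq_lift_le {V : UnitAddTorus (Fin 3) → (EuclideanSpace ℝ (Fin 3))} (hV : Torus.IsSmooth V) :
    cellGradSq (Torus.lift V) ≤ Torus.gradNormSq V := by
  unfold cellGradSq Torus.gradNormSq
  rw [cell_eq_openCube, setIntegral_congr_set PeriodicCylinder.openCube_ae_eq_unitCube,
    Torus.integral_eq_integral_lift_holds (fun y => ∑ i, ‖Torus.partialDeriv i V y‖ ^ 2)]
  have hV1 : Torus.IsContDiff 1 V := hV.isContDiff (by simp)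
  have hpt : ∀ x : (EuclideanSpace ℝ (Fin 3)), Torus.lift (fun y => ∑ i, ‖Torus.partialDeriv i V y‖ ^ 2) x =
      ∑ i, ‖fderiv ℝ (Torus.lift V) x (EuclideanSpace.single i 1)‖ ^ 2 := by
    intro x
    simp only [Torus.lift_apply]
    refine Finset.sum_congr rfl fun i _ => ?_
    rw [Torus.partialDeriv_eq_fderiv_apply hV1, Torus.fderiv_lift]
  have hG : Continuous (fun y => ∑ i, ‖Torus.partialDeriv i V y‖ ^ 2) :=
    continuous_finsetSum _ fun i _ => ((hV.partialDeriv i).continuous.norm).pow 2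
  refine integral_mono_of_nonneg (Eventually.of_forall fun x => by positivity)
    (integrableOn_lift_unitCube hG) (Eventually.of_forall fun x => ?_)
  rw [hpt]
  exact sq_opNorm_le_sum_sq_norm_apply_stdVec _

/-! ### Step 3 holds -/

/-- **`Step_3` holds** (the energy bound (2)/(6), l.738–750): along a classical ℤ³-periodic
solution of the unforced Navier–Stokes system on `ℝ³ × [0,T)`, `ν > 0`,
`∫_Ω|u(t)|² + ∫₀ᵗ∫_Ω‖Du‖² ≤ (1 + 1/(2ν)) ∫_Ω|u(0)|²` for `t < T` — from the torus energy equality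
`½‖U(t)‖² + ν∫₀ᵗ‖∇U‖₂² = ½‖U(0)‖²` (Leray 1934; Doering–Foias 2002 (2.4); tree
`Torus.IsClassicalNSSolutionOn.energy_eq`) for the descended solution `U`. -/
theorem lin2013_step3_holds : Literature.Claims.NS.Lin2013.Step_3 := by
  intro ν hν T hT u p hsol t ht
  obtain ⟨U, P, hU, hu, -⟩ := exists_torus_of_isPeriodicClassicalOn hsol
  have h0S : (0 : ℝ) ∈ Ico 0 T := ⟨le_rfl, hT⟩
  have hIcc : Icc 0 t ⊆ Ico 0 T := fun s hs => ⟨hs.1, hs.2.trans_lt ht.2⟩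
  -- the torus energy equality on `[0, t]`
  have hE := hU.energy_eq (convex_Ico 0 T) ht.1 hIcc
  simp only [Pi.zero_apply, inner_zero_left, integral_zero, intervalIntegral.integral_zero,
    add_zero, Torus.kineticEnergy] at hE
  -- names
  set A : ℝ := ∫ y, ‖U 0 y‖ ^ 2 with hA
  set B : ℝ := ∫ y, ‖U t y‖ ^ 2 with hB
  set X : ℝ := ∫ τ in (0 : ℝ)..t, Torus.gradNormSq (U τ) with hX
  have hB0 : 0 ≤ B := integral_nonneg fun _ => by positivity
  have hA0 : 0 ≤ A := integral_nonneg fun _ => by positivity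
  have hX0 : 0 ≤ X :=
    intervalIntegral.integral_nonneg ht.1 fun τ _ => Torus.gradNormSq_nonneg _
  have hEq : B + 2 * ν * X = A := by linarith
  -- the claim's functionals through the bridge
  have hsq_t : cellSq (u t) = B := by rw [hu t ht, cellSq_lift]
  have hsq_0 : cellSq (u 0) = A := by rw [hu 0 h0S, cellSq_lift]
  have hgrad : (∫ s in (0 : ℝ)..t, cellGradSq (u s)) ≤ X := by
    rw [hX, intervalIntegral.integral_of_le ht.1, intervalIntegral.integral_of_le ht.1]
    have hcont : ContinuousOn (fun τ => Torus.gradNormSq (U τ)) (Ico 0 T) :=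
      hU.smooth_velocity.continuousOn_gradNormSq (convex_Ico 0 T) (uniqueDiffOn_Ico 0 T)
    have hint : IntegrableOn (fun τ => Torus.gradNormSq (U τ)) (Ioc 0 t) volume :=
      ((hcont.mono hIcc).integrableOn_compact isCompact_Icc).mono_set Ioc_subset_Icc_self
    refine integral_mono_of_nonneg ?_ hint ?_
    · exact Eventually.of_forall fun s => integral_nonneg fun _ => by positivity
    · refine (ae_restrict_iff' measurableSet_Ioc).2 (Eventually.of_forall fun s hs => ?_)
      have hsS : s ∈ Ico 0 T := ⟨hs.1.le, hs.2.trans_lt ht.2⟩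
      show cellGradSq (u s) ≤ Torus.gradNormSq (U s)
      rw [hu s hsS]
      exact cellGradSq_lift_le (hU.smooth_velocity.isSmooth_slice hsS)
  -- arithmetic: `B ≤ A`, `X ≤ A/(2ν)`
  have hBA : B ≤ A := by nlinarith
  have hXA : X ≤ A / (2 * ν) := by
    rw [le_div_iff₀ (by positivity)]
    nlinarith
  rw [hsq_t, hsq_0]
  calc B + ∫ s in (0 : ℝ)..t, cellGradSq (u s) ≤ A + A / (2 * ν) := add_le_add hBA (hgrad.trans hXA)
    _ = (1 + 1 / (2 * ν)) * A := by ring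

/-! ### Enstrophy on the cell versus the torus gradient norm (rev 2) -/

/-- For a smooth divergence-free torus field, `∫_{(0,1)³} |curl (lift V)|² = ‖∇V‖₂²`
(`|curl (lift V)(y)|² = |ω(proj y)|²` pointwise, and `∫_{𝕋³}|ω|² = ∫_{𝕋³}|∇V|²` for divergence-free
`V`, Ayala–Protas 2017 (2.3)–(2.4); tree `Torus.norm_curl_lift_sq`,
`integral_torusVorticitySqAt_eq_two_mul_torusEnstrophy`). -/
theorem cellSq_curl_lift {V : UnitAddTorus (Fin 3) → (EuclideanSpace ℝ (Fin 3))}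
    (hV : Torus.IsSmooth V) (hdiv : Torus.IsDivFree V) :
    cellSq (curl (Torus.lift V)) = Torus.gradNormSq V := by
  unfold cellSq
  rw [cell_eq_openCube, setIntegral_congr_set PeriodicCylinder.openCube_ae_eq_unitCube]
  have hpt : (fun x => ‖curl (Torus.lift V) x‖ ^ 2) = Torus.lift (torusVorticitySqAt V) := by
    funext x
    rw [Torus.lift_apply, Torus.norm_curl_lift_sq (hV.isContDiff (by simp))]
  rw [hpt, ← Torus.integral_eq_integral_lift_holds (torusVorticitySqAt V),
    integral_torusVorticitySqAt_eq_two_mul_torusEnstrophy hV hdiv, torusEnstrophy]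
  ring

/-! ### Galilean frame shifts on the torus (rev 2) -/

/-- `∂ᵢ (V(· + a) − c)(x) = (∂ᵢ V)(x + a)`: partial derivatives commute with translations and kill
constants. -/
theorem partialDeriv_comp_add_right_sub_const (i : Fin 3)
    (V : UnitAddTorus (Fin 3) → (EuclideanSpace ℝ (Fin 3))) (a : UnitAddTorus (Fin 3))
    (c : (EuclideanSpace ℝ (Fin 3))) (x : UnitAddTorus (Fin 3)) :
    Torus.partialDeriv i (fun y => V (y + a) - c) x = Torus.partialDeriv i V (x + a) := by
  show deriv (fun t : ℝ => V (x + Torus.proj (t • EuclideanSpace.single i (1 : ℝ)) + a) - c) 0 =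
    deriv (fun t : ℝ => V (x + a + Torus.proj (t • EuclideanSpace.single i (1 : ℝ)))) 0
  rw [deriv_sub_const]
  congr 1
  funext t
  rw [add_right_comm]

/-- `‖∇(V(· + a) − c)‖₂² = ‖∇V‖₂²` (translation invariance of the Haar integral on `𝕋³`). -/
theorem gradNormSq_comp_add_right_sub_const (V : UnitAddTorus (Fin 3) → (EuclideanSpace ℝ (Fin 3)))
    (a : UnitAddTorus (Fin 3)) (c : (EuclideanSpace ℝ (Fin 3))) :
    Torus.gradNormSq (fun y => V (y + a) - c) = Torus.gradNormSq V := by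
  unfold Torus.gradNormSq
  have h : (fun x => ∑ i, ‖Torus.partialDeriv i (fun y => V (y + a) - c) x‖ ^ 2) =
      fun x => (fun z => ∑ i, ‖Torus.partialDeriv i V z‖ ^ 2) (x + a) := by
    funext x
    simp only [partialDeriv_comp_add_right_sub_const]
  rw [h]
  exact integral_add_right_eq_self (fun z => ∑ i, ‖Torus.partialDeriv i V z‖ ^ 2) a

/-! ### Step 2 holds (rev 2) -/

/-- **`Step_2` holds** (§2 opening l.213–214 with §6 l.2436 ff.: «we only need to prove that the
vorticity … belongs to `L^∞(0,T;L²(Ω))`»): a classical ℤ³-periodic solution of the unforced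
Navier–Stokes system on `ℝ³ × [0,T)`, `ν > 0`, whose enstrophy `∫_Ω|curl u(t)|²` is bounded on
`[0,T)` continues to a classical periodic solution on some `[0,T')`, `T' > T`. Proof: descend to
`𝕋³`; the mean velocity `m` is conserved (`Torus.IsClassicalNSSolutionOn.integral_velocity_eq`), so
the Galilean boost `u(t, y + tm) − m` (Majda–Bertozzi 2002 §1.2; tree `galileanBoost_const_Ico`)
is periodic with mean-zero slices and the same enstrophy (`cellSq_curl_lift`,
`gradNormSq_comp_add_right_sub_const`); the enstrophy door
`Torus.classicalNS_continuation_of_gradNormSq_le` (RRS 2016 Lemma 6.11) continues it to `[0,T']`;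
lift back (`of_torus_holds`) and undo the boost. -/
theorem lin2013_step2_holds : Literature.Claims.NS.Lin2013.Step_2 := by
  intro ν hν T hT u p hsol hbound
  obtain ⟨M, hM⟩ := hbound
  have hper := hsol.2
  have h0S : (0 : ℝ) ∈ Ico 0 T := ⟨le_rfl, hT⟩
  -- descend
  obtain ⟨U, P, hU, hu, -⟩ := exists_torus_of_isPeriodicClassicalOn hsol
  -- the conserved mean velocity
  set m : (EuclideanSpace ℝ (Fin 3)) := ∫ y, U 0 y with hm
  have hmean : ∀ t ∈ Ico 0 T, ∫ y, U t y = m := fun t ht =>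
    hU.integral_velocity_eq (convex_Ico 0 T) (fun τ _ => by simp) h0S ht
  -- the Galilean boost on `ℝ³` (periodic again)
  set u₁ : ℝ → (EuclideanSpace ℝ (Fin 3)) → (EuclideanSpace ℝ (Fin 3)) :=
    fun t y => u t (y + t • m) - m with hu₁
  set p₁ : ℝ → (EuclideanSpace ℝ (Fin 3)) → ℝ := fun t y => p t (y + t • m) with hp₁
  have hsol₁ : IsPeriodicClassicalOn (Ico 0 T) ν u₁ p₁ := by
    refine ⟨hsol.1.galileanBoost_const_Ico m, fun t ht => ⟨?_, ?_⟩⟩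
    · exact ((hper t ht).1.comp_add_right (t • m)).sub_const m
    · exact (hper t ht).2.comp_add_right (t • m)
  -- descend the boosted solution and identify it
  obtain ⟨U₁, P₁, hU₁, hu₁U, -⟩ := exists_torus_of_isPeriodicClassicalOn hsol₁
  have hU₁eq : ∀ t ∈ Ico 0 T, U₁ t = fun x => U t (x + Torus.proj (t • m)) - m := by
    intro t ht
    apply Torus.lift_injective
    rw [← hu₁U t ht]
    funext y
    have h1 : u₁ t y = u t (y + t • m) - m := rfl
    rw [h1, hu t ht, Torus.lift_apply, Torus.lift_apply, Torus.proj_add]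
  -- mean zero after the boost
  have hmean₁ : ∀ t ∈ Ico 0 T, Torus.HasZeroMean (U₁ t) := by
    intro t ht
    unfold Torus.HasZeroMean
    rw [hU₁eq t ht]
    have hint : Integrable (U t) volume := (hU.smooth_velocity.isSmooth_slice ht).integrable
    show ∫ x, (U t (x + Torus.proj (t • m)) - m) = 0
    rw [integral_sub (hint.comp_add_right _) (integrable_const m),
      integral_add_right_eq_self (U t) (Torus.proj (t • m)), hmean t ht, integral_const,
      probReal_univ, one_smul, sub_self]
  -- the enstrophy bound survives descent and boost
  have hE : ∀ t ∈ Ico 0 T, Torus.gradNormSq (U₁ t) ≤ M := by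
    intro t ht
    rw [hU₁eq t ht, gradNormSq_comp_add_right_sub_const,
      ← cellSq_curl_lift (hU.smooth_velocity.isSmooth_slice ht) (hU.divFree t ht), ← hu t ht]
    exact hM t ht
  -- the enstrophy door on `𝕋³`
  obtain ⟨T', hTT', U', P', hU', -, hagree⟩ :=
    Torus.classicalNS_continuation_of_gradNormSq_le (d := Fin 3) (by simp) hν hT hU₁ hmean₁ hE
  -- lift back to `ℝ³` and restrict to `[0, T')`
  have hlift : IsClassicalNSSolutionOn (Icc 0 T') ν
      (fun t => Torus.lift ((0 : ℝ → UnitAddTorus (Fin 3) → (EuclideanSpace ℝ (Fin 3))) t))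
      (fun t => Torus.lift (U' t)) (fun t => Torus.lift (P' t)) :=
    IsClassicalNSSolutionOn.of_torus_holds hU'
  have hlift0 : IsClassicalNSSolutionOn (Ico 0 T') ν 0 (fun t => Torus.lift (U' t))
      (fun t => Torus.lift (P' t)) := by
    have h0 : (fun t => Torus.lift ((0 : ℝ → UnitAddTorus (Fin 3) → (EuclideanSpace ℝ (Fin 3))) t)) =
        (0 : ℝ → (EuclideanSpace ℝ (Fin 3)) → (EuclideanSpace ℝ (Fin 3))) := by
      funext t x
      simp [Torus.lift_apply]
    rw [h0] at hlift
    exact hlift.mono Ico_subset_Icc_self (uniqueDiffOn_Ico 0 T')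
  -- undo the boost
  have h2 := hlift0.galileanBoost_const_Ico (-m)
  refine ⟨T', hTT', _, _, ⟨h2, fun t _ => ⟨?_, ?_⟩⟩, fun t ht => ?_⟩
  · have hp : IsLatticePeriodic (Torus.lift (U' t)) := fun j x => Torus.isLatticePeriodic_lift (U' t) j x
    exact (hp.comp_add_right (t • (-m))).sub_const (-m)
  · have hp : IsLatticePeriodic (Torus.lift (P' t)) := fun j x => Torus.isLatticePeriodic_lift (P' t) j x
    exact hp.comp_add_right (t • (-m))
  · funext y
    show Torus.lift (U' t) (y + t • (-m)) - (-m) = u t y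
    rw [hagree t ht, ← hu₁U t ht]
    show u t (y + t • (-m) + t • m) - m - (-m) = u t y
    rw [smul_neg, neg_add_cancel_right, sub_neg_eq_add, sub_add_cancel]

end Summit.NavierStokesRegularity.NavierStokesRegularity.Theorems.Lin2013Salvage

end
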